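/-
Copyright (c) 2026 the pub-hodgecm-mathlib formalisation cell (harness21).  Prover seat hodgecm-mathlib-K2E3-p20 (g0),
Track B «K2-LIT» ∕ h413, line `K2_E3_EllipticInputs`, unit U5Kazhdan, SIGS-TABLE row #20 (`sig_K2E3PseudoCoeffValueAtOneL2`) — the
★-closable REDUCTION half.  2026-09-03.
-/
import Literature.NumberTheory.Rogawski1990.Ch12Sec6   -- ★ carpet `Ch12Sec6.PseudoCoeffTrace` [§12.6 p. 187]; brings ★ `Ch12Sec5.EllipticData` (`IsPseudoCoeff`, `IsL2`, `innerG`, `char`, `orbInt`)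
import HarnessLib

/-!
# K2_E3 road (h413 = stmt-HodgeConjecture-24833), U5-f «THE FORMAL DEGREE `f_π(1) = d(π) > 0`» — REDUCTION to the Plancherel formula
# (discrete part, cuspidal functions) + the orthonormality of the `L²` characters + «`Tr π′(f_π) = ⟨χ_{π′}, χ_π⟩_e`»

Cell `pub/hodgecm-mathlib` (D-0151), Track B, line `Summits/HodgeConjecture/HodgeConjecture/Cruxes/H413/Lines/K2_E3_EllipticInputs.lean`,
unit module `…Lines/K2_E3_EllipticInputsSigs_U5Kazhdan.lean` (87d8b4c974a167d7), socket `sig_K2E3PseudoCoeffValueAtOneL2` (row #20, L–XL):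
«for `π` square-integrable and `f` ANY pseudo-coefficient of `π`, `f(1)` is real and positive».  Helper file (`--supports stmt-HodgeConjecture-24833
--as helper`, no socket closed); THEOREMS ONLY (no `def`, no instance, no notation, no named fact, no `sorry`); the §12.5 datum `𝔇` is a BINDER on
GENERIC carriers `G ⊃ H` (so the theorems apply verbatim at the organ's pinned datum on `U(Φ₃)(L⁺_v)`).

THE MATHEMATICS [Rogawski1990, §12.7, proof of Lemma 12.7.2, p. 194]: «By the Plancherel formula, `f_π(1) = d(π)`», «Formal degrees are positive»
(p. 195).  Spelled out: for `f` a pseudo-coefficient of the square-integrable class `π` [§12.6 p. 187: `f ∈ C_c^∞(G)`, `Φ(γ, f) = 0` on `Gʳ ∖ Gᵉ`,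
`Φ(γ, f) = \overline{χ_π(γ)}` on `Gᵉ`] the regular non-elliptic orbital integrals of `f` vanish («`f` is cuspidal»), so the Plancherel formula of
Harish-Chandra [Waldspurger2003] has no continuous term at `f` (the characters of the representations unitarily induced from proper parabolic
subgroups are supported off `Gᵉ`) and reads
  (DISC-PL)  `f(1) = Σ_{σ ∈ E₂(G)} d(σ) · Tr σ(f)`,  `d(σ) > 0` the formal degree of `σ` for the Haar measure `dg` of the datum;
by «`Tr σ(f_π) = ⟨χ_σ, χ_π⟩_e`» [§12.6 p. 187, «by the Weyl integration formula»; ★ carpet `Ch12Sec6.PseudoCoeffTrace`, derived in house at rung 0 by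
★ `F0P3cStCharTSPctOut.pseudoCoeffTrace_Gqs`] and the orthonormality of the square-integrable characters «`⟨χ_σ, χ_π⟩_e = δ_{σ,π}`» [Prop. 12.6.1 (a)
p. 188 + [K] Thm. K; socket `sig_K2E3KazhdanL2Orthonormal`, row #15] every term but `σ = π` vanishes: `f(1) = d(π)`, a positive real.

WHAT THIS FILE PROVES (sorry-free, generic datum): with the three inputs as HYPOTHESES — `hPCT` (the carpet relation, or only its instance at `f`),
`hOrtho` (orthonormality against `π` on the `L²` classes — the consequent of `sig_K2E3KazhdanL2Orthonormal` BY SHAPE) and `hPL` (DISC-PL as a `HasSum`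
over the subtype of `L²` classes, for cuspidal test functions) —
* §1 **`apply_one_eq_formalDegree_of_discretePlancherel`**: `f 1 = d π`;
* §2 **`apply_one_im_zero_re_pos_of_discretePlancherel`**: `(f 1).im = 0 ∧ 0 < (f 1).re` — the consequent of `sig_K2E3PseudoCoeffValueAtOneL2`
  TOKEN FOR TOKEN (so row #20 = DISC-PL ⊕ row #15 ⊕ PCT, the last being ★ at rung 0);
* §3 **`exists_formalDegree_of_discretePlancherel`**: the organ's O3 letter «formal degrees» `∃ d, (∀ π f, 𝔇.IsL2 π → 𝔇.IsPseudoCoeff π f →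
  f 1 = d π) ∧ (∀ π, 𝔇.IsL2 π → 0 < d π)` (★ `F0P3cStCharTSRung0Ten` :213, ★ `F0P3cStCharTSPcValueAtOne` §2) from the same three inputs, WITHOUT the
  germ clause (GERM-3).
WHAT IT DOES NOT PROVE: DISC-PL itself (Harish-Chandra's Plancherel theorem for `U(3)(F)`, discrete part — no layer in the tree: the only
formal-degree currency is the posited field ★ `Ch12Sec7.Dict.fdeg`), nor row #15.  HONEST LABEL: count-neutral; HC_CM is proved only modulo the 7
printed citations (2 remaining named inputs: hLiu418 = stmt-HodgeConjecture-24832, h413 = stmt-HodgeConjecture-24833) until rung 0 closes; this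
`--supports` helper retires nothing by itself.

## References
* [Rogawski1990] J. D. Rogawski, *Automorphic Representations of Unitary Groups in Three Variables*, Ann. of Math. Stud. 123 (1990): §12.6
  p. 187 (pseudo-coefficients, «`Tr(π′(f_π)) = ⟨χ_{π′}, χ_π⟩_e`»), Prop. 12.6.1 (a) p. 188; §12.7 proof of Lemma 12.7.2 pp. 194–195 («By the
  Plancherel formula, `f_π(1) = d(π)`», «Formal degrees are positive»).
* [Waldspurger2003] J.-L. Waldspurger, *La formule de Plancherel pour les groupes p-adiques (d'après Harish-Chandra)*, J. Inst. Math. Jussieu 2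
  (2003) 235–333 (the Plancherel formula; formal degrees of the discrete series).
* [Kazhdan1986CuspidalGeometry] D. Kazhdan, *Cuspidal geometry of p-adic groups*, J. Analyse Math. 47 (1986) 1–36 (cuspidal functions; [K] of the print).
-/

set_option autoImplicit false
-- the mandated namespace has the single-problem summit's repeated segment (`HodgeConjecture.HodgeConjecture`)
set_option linter.dupNamespace false

noncomputable section

open MeasureTheory
open Literature.NumberTheory.Rogawski1990 Literature.NumberTheory.Rogawski1990.Ch12Sec5
open Literature.NumberTheory.Automorphic

namespace Summit.HodgeConjecture.HodgeConjecture.Cruxes.H413.K2E3PseudoCoeffValueAtOneL2OfPlancherel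

section Generic

variable {G H' : Type} [Group G] [TopologicalSpace G] [IsTopologicalGroup G] [MeasurableSpace G]
  [∀ γ : G, MeasurableSpace (G ⧸ Subgroup.centralizer ({γ} : Set G))] [MeasurableSpace (G ⧸ Subgroup.center G)]
  [Group H'] [TopologicalSpace H'] [IsTopologicalGroup H'] [MeasurableSpace H']

/-! ## §1 `f_π(1) = d(π)` from (DISC-PL), the trace identity at `f_π`, and orthonormality against `π` -/

open scoped Classical in
/-- **«By the Plancherel formula, `f_π(1) = d(π)`» — POINTWISE form.**  Let `𝔇` be a §12.5 datum on `G ⊃ H`, `π` a square-integrable class and `f`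
a pseudo-coefficient of `π` [§12.6 p. 187].  IF (i) `Tr σ(f) = ⟨χ_σ, χ_π⟩_e` for every square-integrable `σ` (the carpet relation
`Ch12Sec6.PseudoCoeffTrace` at `f`; «by the Weyl integration formula», p. 187), (ii) `⟨χ_σ, χ_π⟩_e = δ_{σ,π}` for every square-integrable `σ`
(Prop. 12.6.1 (a) + [K] Thm. K — row #15), and (iii) (DISC-PL) the Plancherel formula at the cuspidal function `f`:
`Σ_{σ ∈ E₂(G)} d(σ) Tr σ(f) = f(1)` (as a `HasSum` over the `L²` classes), THEN `f(1) = d(π)`.  Proof: by (i)–(ii) the Plancherel series has the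
single non-zero term `d(π)` at `σ = π`. [cite: Rogawski1990, §12.7 Lemma 12.7.2 (proof) p. 194] [cite: Rogawski1990, §12.6 p. 187]
[cite: Waldspurger2003, formule de Plancherel] -/
theorem apply_one_eq_formalDegree_of_hasSum (𝔇 : EllipticData G H') {π : IrrClass G} {f : G → ℂ} (d : IrrClass G → ℝ)
    (hTr : ∀ σ : IrrClass G, 𝔇.IsL2 σ → σ.smoothTrace 𝔇.μG f = 𝔇.innerG (𝔇.char σ) (𝔇.char π))
    (hOrtho : ∀ σ : IrrClass G, 𝔇.IsL2 σ → 𝔇.innerG (𝔇.char σ) (𝔇.char π) = if σ = π then 1 else 0)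
    (hPLf : HasSum (fun σ : {σ : IrrClass G // 𝔇.IsL2 σ} => ((d (σ : IrrClass G) : ℝ) : ℂ) * (σ : IrrClass G).smoothTrace 𝔇.μG f) (f 1))
    (hπ : 𝔇.IsL2 π) : f 1 = (d π : ℂ) := by
  -- the Plancherel series of `f` is the single term `d(π)` at `σ = π`
  have hterm : (fun σ : {σ : IrrClass G // 𝔇.IsL2 σ} => ((d (σ : IrrClass G) : ℝ) : ℂ) * (σ : IrrClass G).smoothTrace 𝔇.μG f) =
      fun σ : {σ : IrrClass G // 𝔇.IsL2 σ} => if σ = ⟨π, hπ⟩ then ((d π : ℝ) : ℂ) else 0 := by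
    funext σ
    rw [hTr σ σ.2, hOrtho σ σ.2]
    by_cases hσ : σ = ⟨π, hπ⟩
    · subst hσ
      simp
    · have hσ' : (σ : IrrClass G) ≠ π := fun h => hσ (Subtype.ext h)
      rw [if_neg hσ', if_neg hσ, mul_zero]
  rw [hterm] at hPLf
  exact (hPLf.unique (hasSum_ite_eq _ _))

open scoped Classical in
/-- **«By the Plancherel formula, `f_π(1) = d(π)`»** [Rogawski1990, p. 194] at a §12.5 datum `𝔇` on generic carriers, from THREE inputs as hypotheses:
`hPCT` — «`Tr π′(f_π) = ⟨χ_{π′}, χ_π⟩_e`» for every class `π′` and every pseudo-coefficient (★ carpet `Ch12Sec6.PseudoCoeffTrace 𝔇`, p. 187);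
`hOrtho` — the square-integrable characters are orthonormal for `⟨ , ⟩_e` (Prop. 12.6.1 (a) + [K] Thm. K; the consequent of socket
`sig_K2E3KazhdanL2Orthonormal` BY SHAPE); `hPL` — (DISC-PL) for every `f ∈ C_c^∞(G)` whose regular non-elliptic orbital integrals vanish (a CUSPIDAL
function — every pseudo-coefficient is one, by the first clause of its definition), `f(1) = Σ_{σ ∈ E₂(G)} d(σ) Tr σ(f)` (Harish-Chandra's Plancherel
formula: at a cuspidal `f` the continuous spectrum contributes nothing).  THEN every pseudo-coefficient `f` of a square-integrable `π` has `f(1) = d(π)`.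
[cite: Rogawski1990, §12.7 Lemma 12.7.2 (proof) p. 194] [cite: Rogawski1990, §12.6 Prop. 12.6.1 (a) p. 188] [cite: Waldspurger2003, formule de Plancherel] -/
theorem apply_one_eq_formalDegree_of_discretePlancherel (𝔇 : EllipticData G H') (hPCT : Ch12Sec6.PseudoCoeffTrace 𝔇)
    (hOrtho : ∀ π π' : IrrClass G, 𝔇.IsL2 π → 𝔇.IsL2 π' → 𝔇.innerG (𝔇.char π) (𝔇.char π') = if π = π' then 1 else 0)
    (d : IrrClass G → ℝ)
    (hPL : ∀ f : G → ℂ, f ∈ SchwartzBruhat G → (∀ γ ∈ 𝔇.regG \ 𝔇.ellG, 𝔇.orbInt γ f = 0) →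
      HasSum (fun σ : {σ : IrrClass G // 𝔇.IsL2 σ} => ((d (σ : IrrClass G) : ℝ) : ℂ) * (σ : IrrClass G).smoothTrace 𝔇.μG f) (f 1))
    {π : IrrClass G} {f : G → ℂ} (hπ : 𝔇.IsL2 π) (hf : 𝔇.IsPseudoCoeff π f) : f 1 = (d π : ℂ) :=
  apply_one_eq_formalDegree_of_hasSum 𝔇 d (fun σ _ => hPCT π σ f hf) (fun σ hσ => hOrtho σ π hσ hπ) (hPL f hf.1 hf.2.1) hπ

/-! ## §2 The consequent of `sig_K2E3PseudoCoeffValueAtOneL2`: `f(1)` is real and positive -/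

open scoped Classical in
/-- **ROW #20's CONSEQUENT, TOKEN FOR TOKEN, from (DISC-PL) ⊕ orthonormality ⊕ the trace identity**: for `π` square-integrable and `f` ANY
pseudo-coefficient of `π`, `(f 1).im = 0 ∧ 0 < (f 1).re` — «`f_π(1) = d(π)`», «Formal degrees are positive» [Rogawski1990, pp. 194–195] — GIVEN
`hPCT` (★ carpet `Ch12Sec6.PseudoCoeffTrace`), `hOrtho` (row #15's consequent by shape) and (DISC-PL) with positive formal degrees `hdpos`.  This is
the reduction «`sig_K2E3PseudoCoeffValueAtOneL2` ⟸ DISC-PL ⊕ `sig_K2E3KazhdanL2Orthonormal` ⊕ PCT» (PCT is ★ in house at rung 0,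
`F0P3cStCharTSPctOut.pseudoCoeffTrace_Gqs`). [cite: Rogawski1990, §12.7 Lemma 12.7.2 (proof) pp. 194–195] [cite: Waldspurger2003, formule de Plancherel] -/
theorem apply_one_im_zero_re_pos_of_discretePlancherel (𝔇 : EllipticData G H') (hPCT : Ch12Sec6.PseudoCoeffTrace 𝔇)
    (hOrtho : ∀ π π' : IrrClass G, 𝔇.IsL2 π → 𝔇.IsL2 π' → 𝔇.innerG (𝔇.char π) (𝔇.char π') = if π = π' then 1 else 0)
    (d : IrrClass G → ℝ) (hdpos : ∀ σ : IrrClass G, 𝔇.IsL2 σ → 0 < d σ)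
    (hPL : ∀ f : G → ℂ, f ∈ SchwartzBruhat G → (∀ γ ∈ 𝔇.regG \ 𝔇.ellG, 𝔇.orbInt γ f = 0) →
      HasSum (fun σ : {σ : IrrClass G // 𝔇.IsL2 σ} => ((d (σ : IrrClass G) : ℝ) : ℂ) * (σ : IrrClass G).smoothTrace 𝔇.μG f) (f 1)) :
    ∀ (π : IrrClass G) (f : G → ℂ), 𝔇.IsL2 π → 𝔇.IsPseudoCoeff π f → (f 1).im = 0 ∧ 0 < (f 1).re := by
  intro π f hπ hf
  rw [apply_one_eq_formalDegree_of_discretePlancherel 𝔇 hPCT hOrtho d hPL hπ hf, Complex.ofReal_im, Complex.ofReal_re]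
  exact ⟨rfl, hdpos π hπ⟩

/-! ## §3 The organ's O3 letter «formal degrees» from the same three inputs (no germ clause) -/

open scoped Classical in
/-- **THE O3 LETTER «FORMAL DEGREES» of the (S-𝔑) block** (★ `F0P3cStCharTSRung0Ten` :213 ∕ ★ `F0P3cStCharTSPcValueAtOne` §2, there obtained from
POS-ONE through the germ clause (GERM-3)): `∃ d, (∀ π f, 𝔇.IsL2 π → 𝔇.IsPseudoCoeff π f → f 1 = d π) ∧ (∀ π, 𝔇.IsL2 π → 0 < d π)` — here read
off (DISC-PL) ⊕ orthonormality ⊕ the trace identity directly, the witness being the formal degrees of (DISC-PL) themselves («`f_π(1) = d(π)`»,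
«Formal degrees are positive»). [cite: Rogawski1990, §12.7 Lemma 12.7.2 (proof) pp. 194–195] [cite: Waldspurger2003, formule de Plancherel] -/
theorem exists_formalDegree_of_discretePlancherel (𝔇 : EllipticData G H') (hPCT : Ch12Sec6.PseudoCoeffTrace 𝔇)
    (hOrtho : ∀ π π' : IrrClass G, 𝔇.IsL2 π → 𝔇.IsL2 π' → 𝔇.innerG (𝔇.char π) (𝔇.char π') = if π = π' then 1 else 0)
    (hPL : ∃ d : IrrClass G → ℝ, (∀ σ : IrrClass G, 𝔇.IsL2 σ → 0 < d σ) ∧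
      ∀ f : G → ℂ, f ∈ SchwartzBruhat G → (∀ γ ∈ 𝔇.regG \ 𝔇.ellG, 𝔇.orbInt γ f = 0) →
        HasSum (fun σ : {σ : IrrClass G // 𝔇.IsL2 σ} => ((d (σ : IrrClass G) : ℝ) : ℂ) * (σ : IrrClass G).smoothTrace 𝔇.μG f) (f 1)) :
    ∃ d : IrrClass G → ℝ, (∀ (π : IrrClass G) (f : G → ℂ), 𝔇.IsL2 π → 𝔇.IsPseudoCoeff π f → f 1 = (d π : ℂ)) ∧
      (∀ π : IrrClass G, 𝔇.IsL2 π → 0 < d π) := by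
  obtain ⟨d, hdpos, hPL⟩ := hPL
  exact ⟨d, fun π f hπ hf => apply_one_eq_formalDegree_of_discretePlancherel 𝔇 hPCT hOrtho d hPL hπ hf, hdpos⟩

end Generic

end Summit.HodgeConjecture.HodgeConjecture.Cruxes.H413.K2E3PseudoCoeffValueAtOneL2OfPlancherel

end
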